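import Summits.Ventures.KdS.RouteWEulerRL
import HarnessLib

/-!
# Venture KdS — ROUTE W above the event-horizon integrability line: every spin `s`

HONEST FRAMING (venture `Summits/Ventures/KdS`, cell `pub-kds`; a theorem about the radial
Teukolsky ODE of Kerr–de Sitter in the tree's generic-boundary vocabulary, NOT a mode-stability
claim beyond what is stated): route W (`RouteW.radial_vanishing_lt_one`, landed, 0 cited facts)
uses the hypothesis `s < 1` at exactly ONE place — to get the integrability `Re(2η₁ − s) > −1` of
the event-horizon branch in the Euler gauge (`Re η₁ = Im ω/(2κ₁)`). This file records the same
composition with that hypothesis replaced by what it is used for,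
`(s − 1)·κ₁ < Im ω` (`radial_vanishing_of_im_gt`), so that the conclusion of Casals–Teixeira da
Costa's Proposition 3.8 / Theorem 3.10 (upper half-plane, generic bullets) holds for EVERY real
spin `s` in the region `Im ω > max(0, (s−1)κ₁)` — no spin flip, no Teukolsky–Starobinsky map. In
particular, on the event-horizon threshold ray `Re ω = m ϖ₁` Proposition 3.8's printed pair
condition for `m₁ + m₂ = s − 2η₁` IS `(s−1)κ₁ < Im ω` (`pairCondition_event_iff`, landed), so there
the cited fact `CasalsTeixeiraDaCosta2022_partialModeStabilityProp38` needs nothing beyond route W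
for any spin (`radial_vanishing_eventRay`). What remains of H3 for `s ≥ 1` after this file is the
strip `0 < Im ω ≤ (s−1)κ₁` off the ray `Re ω = mϖ₁` — the object of the Teukolsky–Starobinsky
transfer (`RouteW.SpinFlip`, STRUCTURE.md C3), treated separately.

References: Casals–Teixeira da Costa, Commun. Math. Phys. 394 (2022) 797–832
[CasalsTeixeiradacosta2022], Prop. 3.8, Cor. 3.9, Thm. 3.10 (Step 2).
-/

noncomputable section

open Set Complex

namespace Summit.Ventures.KdS

namespace RouteW

open Literature.Analysis.ODE Literature.Analysis.ODE.GeneralHeun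
open Literature.Geometry.Lorentzian Literature.Geometry.Lorentzian.KerrDeSitter

/-- The Euler-gauge integrability at the event horizon: `Re(2η₁ − s) > −1` iff
`(s − 1)κ₁ < Im ω` (`Re η₁ = Im ω/(2κ₁)`, `κ₁ > 0`). -/
theorem re_branch_gt_neg_one_iff {M a Λ : ℝ} (hsub : IsSubextremal M a Λ) (s : ℝ) (ω : ℂ) (m : ℝ) :
    -1 < (2 * etaEvent M a Λ ω m - (s : ℂ)).re ↔
      (s - 1) * surfaceGravity M a Λ (rPlus M a Λ) < ω.im := by
  have hκ₁ := surfaceGravity_rPlus_pos hsub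
  have h1 : (2 * etaEvent M a Λ ω m - (s : ℂ)).re = 2 * (etaEvent M a Λ ω m).re - s := by
    simp [Complex.mul_re]
  rw [h1, etaEvent_re]
  have h2 : 2 * (ω.im / (2 * surfaceGravity M a Λ (rPlus M a Λ))) =
      ω.im / surfaceGravity M a Λ (rPlus M a Λ) := by
    field_simp
  rw [h2]
  constructor
  · intro h
    have h3 : s - 1 < ω.im / surfaceGravity M a Λ (rPlus M a Λ) := by linarith
    exact (lt_div_iff₀ hκ₁).mp h3
  · intro h
    have h3 : s - 1 < ω.im / surfaceGravity M a Λ (rPlus M a Λ) := (lt_div_iff₀ hκ₁).mpr h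
    linarith

/-- **Route W for every spin above the integrability line.** `Transfer`, `EulerRLNonRes`,
`GaugeGlue` and `SwappedEnergyVanishing` imply: for subextremal `(M,a,Λ)`, `0 ≤ a`, ANY real `s`,
`Im ω > 0` with `(s−1)κ₁ < Im ω`, `Im(λ̄ω̄) ≤ 0`, `|ω| ∉ |m|(0,Ω_SR)` and the pair condition for
`p₃ = −2(η₁+η₀)`, every generic-boundary radial solution vanishes on `(r₊, r_c)`. The proof is the
landed composition `radial_vanishing_of_routeW_nonres_lt_one` verbatim, with the single use of
`s < 1` (the bound `Re(2η₁ − s) > −1`) supplied by `re_branch_gt_neg_one_iff` instead. PROVED. -/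
theorem radial_vanishing_of_routeW_nonres_of_im_gt (kA : Transfer) (kB : EulerRLNonRes)
    (kG : GaugeGlue) (k2 : SwappedEnergyVanishing) {M a Λ s : ℝ} {ω : ℂ} {m : ℝ} {lam : ℂ}
    {R : ℝ → ℂ} (hsub : IsSubextremal M a Λ) (ha : 0 ≤ a)
    (hhi : (s - 1) * surfaceGravity M a Λ (rPlus M a Λ) < ω.im) (hω : 0 < ω.im)
    (hlam : (lambdaBar a Λ s ω m lam * (starRingEnd ℂ) ω).im ≤ 0)
    (hSR : ¬(0 < ‖ω‖ ∧ ‖ω‖ < |m| * superradiantUpper M a Λ))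
    (hp₃ : PairCondition (-2 * (etaEvent M a Λ ω m + etaCauchy M a Λ ω m)))
    (hR : IsRadialTeukolskySolution M a Λ s ω m lam R) (hin : IsIngoingAtEventHorizon M a Λ s ω m R)
    (hout : IsOutgoingAtCosmoHorizon M a Λ ω m R) :
    ∀ r ∈ Ioo (rPlus M a Λ) (rCosmo M a Λ), R r = 0 := by
  obtain ⟨hz₂, v, hv, hvR⟩ := kA M a Λ s ω m lam R hsub hR hin hout
  set η₀ := etaCauchy M a Λ ω m with hη₀
  set η₁ := etaEvent M a Λ ω m with hη₁
  set η₂ := etaCosmo M a Λ ω m with hη₂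
  set z₂ := zTwo M a Λ with hz₂def
  have hF := eulerGauge_fuchs (mass₁ M a Λ s ω m) (mass₂ M a Λ ω m) (mass₃ M a Λ s ω m)
    (mass₄ M a Λ ω m)
  have hroot := euler_exponent_root (mass₂ M a Λ ω m) (mass₃ M a Λ s ω m) (mass₄ M a Λ ω m)
  have hρ : 2 * etaEvent M a Λ ω m - (s : ℂ) =
      1 - eulerGaugeδ (mass₁ M a Λ s ω m) (mass₂ M a Λ ω m) := by
    unfold mass₁ mass₂
    rw [eulerGaugeδ_eta]
    ring
  -- the ONLY change w.r.t. the `s < 1` version: integrability from `(s−1)κ₁ < Im ω`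
  have hre : -1 < (2 * etaEvent M a Λ ω m - (s : ℂ)).re :=
    (re_branch_gt_neg_one_iff hsub s ω m).mpr hhi
  have hnr : ∀ n : ℕ, 2 * etaEvent M a Λ ω m - (s : ℂ) +
      eulerGaugeα (mass₂ M a Λ ω m) (mass₃ M a Λ s ω m) - 1 ≠ -((n : ℂ) + 1) := by
    intro n
    unfold mass₂ mass₃
    rw [rho_add_eta_sub_one_eq]
    exact nonres_of_pairCondition hp₃ n
  obtain ⟨u, hu, huv⟩ := kB z₂ _ _ _ _ _ _ _ _ v hz₂ hF hroot hρ hre hnr hv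
  rw [euler_swap_α, euler_swap_β, euler_swap_γ, euler_swap_δ, euler_swap_ε, euler_swap_q] at hu
  obtain ⟨Rt, hRt, hRtu⟩ := kG z₂ (mass₁ M a Λ s ω m) (mass₃ M a Λ s ω m) (mass₂ M a Λ ω m)
    (mass₄ M a Λ ω m) (bigE M a Λ s ω m lam) _ u hz₂ hu
  have he₁ : 2 * etaEvent M a Λ ω m - (s : ℂ) + eulerGaugeα (mass₂ M a Λ ω m) (mass₃ M a Λ s ω m)
        - 1 + eulerGaugeδ (mass₁ M a Λ s ω m) (mass₃ M a Λ s ω m) / 2 =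
      1 / 2 + etaCauchy M a Λ ω m + etaEvent M a Λ ω m := by
    unfold mass₁ mass₂ mass₃
    rw [eulerGaugeα_eta, eulerGaugeδ_swap_eta]
    ring
  have he₂ : eulerGaugeε (mass₂ M a Λ ω m) (mass₄ M a Λ ω m) / 2 =
      1 / 2 - etaCauchy M a Λ ω m - etaCosmo M a Λ ω m := by
    unfold mass₂ mass₄
    rw [eulerGaugeε_swap_eta]
    ring
  rw [he₁, he₂] at hRt
  have hsub' := hsub
  obtain ⟨hM, hΛ, h01, h12, -⟩ := hsub'
  have hr₀ : 0 ≤ rMinus M a Λ := rMinus_nonneg M a Λ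
  have hcoef : ∀ z ∈ Ioo 1 z₂,
      sqcdCoeff (mass₁ M a Λ s ω m) (mass₃ M a Λ s ω m) (mass₂ M a Λ ω m) (mass₄ M a Λ ω m)
          (bigE M a Λ s ω m lam) (z₂ : ℂ) z = tildeCoeff M a Λ s ω m lam z := by
    intro z hz
    obtain ⟨hz1, hzz⟩ := hz
    unfold tildeCoeff bigE mass₁ mass₂ mass₃ mass₄
    rw [hz₂def] at hzz ⊢
    unfold zTwo
    symm
    refine ctdcTilde_eq_sqcd_swap (s : ℂ) η₀ η₁ η₂ (ltBlock M a Λ s ω m lam) ?_ ?_ ?_ ?_ ?_ ?_ ?_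
    · exact_mod_cast (sub_pos.mpr h01).ne'
    · have : 0 < rCosmo M a Λ + (rMinus M a Λ + rPlus M a Λ + rCosmo M a Λ) := by linarith
      exact_mod_cast this.ne'
    · have : 0 < rPlus M a Λ + rCosmo M a Λ := by linarith
      exact_mod_cast this.ne'
    · have : (0 : ℝ) < z := by linarith
      exact_mod_cast this.ne'
    · exact sub_ne_zero.mpr (by exact_mod_cast (ne_of_gt hz1))
    · unfold zTwo at hzz
      exact sub_ne_zero.mpr (by exact_mod_cast (ne_of_gt hzz))
    · rw [hz₂def] at hz₂
      unfold zTwo at hz₂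
      have : (0 : ℝ) < ctdcZ₂ (rMinus M a Λ) (rPlus M a Λ) (rCosmo M a Λ) := by linarith
      exact_mod_cast this.ne'
  have hRt' : NormalFormModeData z₂ (tildeCoeff M a Λ s ω m lam)
      (1 / 2 + etaCauchy M a Λ ω m + etaEvent M a Λ ω m)
      (1 / 2 - etaCauchy M a Λ ω m - etaCosmo M a Λ ω m) Rt := hRt.congr hcoef
  have hRt0 := k2 M a Λ s ω m lam Rt hsub ha hω hlam hSR hRt'
  exact hvR (huv (hRtu hRt0))

/-- **Route W, discharged, for every spin above the integrability line.** For subextremal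
`(M,a,Λ)`, `0 ≤ a`, any real spin `s`, `Im ω > 0`, `(s−1)κ₁ < Im ω`, `Im(λ̄ω̄) ≤ 0`,
`|ω| ∉ |m|(0,Ω_SR)` and Prop. 3.8's pair condition for `−2(η₁+η₀)`, every classical radial Teukolsky
solution on `(r₊, r_c)` that is ingoing at `𝓗⁺` and outgoing at `𝓗⁺_c` (generic bullets) vanishes
identically. Inputs: `transfer_holds`, `eulerRLNonRes_holds`, `gaugeGlue_holds`,
`swappedEnergyVanishing_holds` — no cited fact, no open hypothesis. For `s ≤ 1` the extra
hypothesis is implied by `Im ω > 0`; for `s = 2` it reads `Im ω > κ₁`. PROVED. -/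
theorem radial_vanishing_of_im_gt {M a Λ s : ℝ} {ω : ℂ} {m : ℝ} {lam : ℂ} {R : ℝ → ℂ}
    (hsub : IsSubextremal M a Λ) (ha : 0 ≤ a)
    (hhi : (s - 1) * surfaceGravity M a Λ (rPlus M a Λ) < ω.im) (hω : 0 < ω.im)
    (hlam : (lambdaBar a Λ s ω m lam * (starRingEnd ℂ) ω).im ≤ 0)
    (hSR : ¬(0 < ‖ω‖ ∧ ‖ω‖ < |m| * superradiantUpper M a Λ))
    (hp₃ : PairCondition (-2 * (etaEvent M a Λ ω m + etaCauchy M a Λ ω m)))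
    (hR : IsRadialTeukolskySolution M a Λ s ω m lam R) (hin : IsIngoingAtEventHorizon M a Λ s ω m R)
    (hout : IsOutgoingAtCosmoHorizon M a Λ ω m R) :
    ∀ r ∈ Ioo (rPlus M a Λ) (rCosmo M a Λ), R r = 0 :=
  radial_vanishing_of_routeW_nonres_of_im_gt transfer_holds eulerRLNonRes_holds gaugeGlue_holds
    swappedEnergyVanishing_holds hsub ha hhi hω hlam hSR hp₃ hR hin hout

/-- `s < 1` is the special case `(s−1)κ₁ < 0 < Im ω` (consistency with the landed
`radial_vanishing_lt_one`). -/
theorem im_gt_of_lt_one {M a Λ s : ℝ} (hsub : IsSubextremal M a Λ) (hs : s < 1) {ω : ℂ}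
    (hω : 0 < ω.im) : (s - 1) * surfaceGravity M a Λ (rPlus M a Λ) < ω.im := by
  have hκ₁ := surfaceGravity_rPlus_pos hsub
  have : (s - 1) * surfaceGravity M a Λ (rPlus M a Λ) < 0 := mul_neg_of_neg_of_pos (by linarith) hκ₁
  linarith

/-- **The event-horizon threshold ray, every spin.** On `Re ω = m ϖ₁`, Proposition 3.8's printed
pair condition for `m₁ + m₂ = s − 2η₁` is exactly `(s−1)κ₁ < Im ω` (`pairCondition_event_iff`), so
there the conclusion of the cited fact `CasalsTeixeiraDaCosta2022_partialModeStabilityProp38` holds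
for every real spin by route W alone. PROVED. -/
theorem radial_vanishing_eventRay {M a Λ s : ℝ} {ω : ℂ} {m : ℝ} {lam : ℂ} {R : ℝ → ℂ}
    (hsub : IsSubextremal M a Λ) (ha : 0 ≤ a) (hω : 0 < ω.im)
    (hray : ω.re = m * horizonAngVel a (rPlus M a Λ))
    (hp₁ : PairCondition ((s : ℂ) - 2 * etaEvent M a Λ ω m))
    (hlam : (lambdaBar a Λ s ω m lam * (starRingEnd ℂ) ω).im ≤ 0)
    (hSR : ¬(0 < ‖ω‖ ∧ ‖ω‖ < |m| * superradiantUpper M a Λ))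
    (hp₃ : PairCondition (-2 * (etaEvent M a Λ ω m + etaCauchy M a Λ ω m)))
    (hR : IsRadialTeukolskySolution M a Λ s ω m lam R) (hin : IsIngoingAtEventHorizon M a Λ s ω m R)
    (hout : IsOutgoingAtCosmoHorizon M a Λ ω m R) :
    ∀ r ∈ Ioo (rPlus M a Λ) (rCosmo M a Λ), R r = 0 :=
  radial_vanishing_of_im_gt hsub ha
    ((pairCondition_event_iff (surfaceGravity_rPlus_pos hsub) hray).mp hp₁) hω hlam hSR hp₃ hR hin hout

/-- **H3 restricted to `Im ω > (s−1)κ₁` is a theorem.** The cited fact's conclusion, with all its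
printed binders, under the one extra hypothesis `(s−1)κ₁ < Im ω` (void for `s ≤ 1`). PROVED. -/
theorem prop38_of_im_gt (M a Λ s : ℝ) (ω : ℂ) (m : ℝ) (lam : ℂ) (hsub : IsSubextremal M a Λ)
    (ha : 0 ≤ a) (hhi : (s - 1) * surfaceGravity M a Λ (rPlus M a Λ) < ω.im) (hω : 0 < ω.im)
    (hlam : (lambdaBar a Λ s ω m lam * (starRingEnd ℂ) ω).im ≤ 0)
    (hSR : ¬(0 < ‖ω‖ ∧ ‖ω‖ < |m| * superradiantUpper M a Λ))
    (hp₃ : PairCondition (-2 * (etaEvent M a Λ ω m + etaCauchy M a Λ ω m)))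
    (R : ℝ → ℂ) (hR : IsRadialTeukolskySolution M a Λ s ω m lam R)
    (hin : IsIngoingAtEventHorizon M a Λ s ω m R) (hout : IsOutgoingAtCosmoHorizon M a Λ ω m R) :
    ∀ r ∈ Ioo (rPlus M a Λ) (rCosmo M a Λ), R r = 0 :=
  radial_vanishing_of_im_gt hsub ha hhi hω hlam hSR hp₃ hR hin hout

end RouteW

end Summit.Ventures.KdS
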